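import Summits.BirchSwinnertonDyer.BirchSwinnertonDyer.Theorems.ErratumRoadFiveNonSurjCornerFiveJLine
import Literature.NumberTheory.EllipticCurves.Fouquet2025.Assumption34TwistLocusProofs
import Literature.NumberTheory.EllipticCurves.BSDSelmerSkinnerThmBProofs
import HarnessLib

/-!
# Route `ErratumRoadFive` (rung K2), crux `NonSurjCorner` (item stmt-BirchSwinnertonDyer-19065):
# THE PARAMETER `t` OF A CORNER PAIR AT `5` — on Zywina's `J₉`-line a multiplicative `5` forces
# `v₅(t) < 0`, and then `ord₅ Δ_min = −5·v₅(t)`: the crux binder `5 ∣ ord₅ Δ_min` (and `ord₅ Δ_min ≥ 5`)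
# read off the parametrisation (cell `bsd-stepL`, seat `bsd-stepL-corner5-p2` g5, WIDTH-LEVER lane B;
# `--supports stmt-BirchSwinnertonDyer-19065 --as helper`)

WHY THIS FILE. `…NonSurjCornerFiveJLine` (this lane g5) gives every corner pair at `5` a parameter
`t ∈ ℚ` with `j(E) = t³(t² + 5t + 40)` (Zywina Thm. 1.4, `i = 9`, by name). This file computes the
`5`-adic shape of such a `t` from the single local fact that `5` is MULTIPLICATIVE (`v₅(j) = −v₅(Δ_min) < 0`,
tree theorem `Fouquet2025.padicValRat_j_of_hasMultiplicativeReductionAtPrime` + `v₅(Δ_min) ≥ 1`):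

* `padicValRat_J9_of_padicValRat_neg` — for `v₅(t) < 0`: `v₅(t³(t²+5t+40)) = 5·v₅(t)` (ultrametric:
  `v₅(t²) = 2v₅(t) < 1 + v₅(t) = v₅(5t+40)`);
* `padicValRat_J9_nonneg_of_padicValRat_nonneg` — for `v₅(t) ≥ 0`: `v₅(t³(t²+5t+40)) ≥ 0`;
* **`padicValRat_lt_zero_of_mult_of_j_eq_J9`** / **`ordMinimalDiscriminant_eq_of_mult_of_j_eq_J9`**: for
  `W/ℚ` globally minimal with `Mult W 5` and `j(W) = t³(t²+5t+40)`: `v₅(t) < 0` and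
  `v₅(Δ_min(W)) = −5·v₅(t)`; hence `5 ∣ v₅(Δ_min)` and `5 ≤ v₅(Δ_min)`
  (`five_dvd_…`, `five_le_…`) — on the data of record all 64 census corner pairs have `v₅(t) = −1`,
  `v₅(Δ_min) = 5` (HOME/corner5/g5/data/corner5_J9_check.tsv);
* **`NonSurjCorner.exists_t_five`**: every corner pair at `5` has a parameter `t` with
  `j = t³(t²+5t+40)`, `v₅(t) < 0` and `v₅(Δ_min) = −5·v₅(t)` (mod Zywina's fact by name, `hZ`).
  So the binder `5 ∣ ord₅ Δ_min` of the crux, idle by g3's image argument (tame inertia), is here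
  VISIBLE ON THE CURVE `X_{G₉}`: the `j`-map has ramification index `5` at the cusp `t = ∞`.

HONEST FRAMING: elementary valuation bookkeeping + the imported structure theorems; nothing here proves
the crux, a registered stub or BSD for any class; no census number moves (T7).
References: [Zywina2015] §1.3 (`J₉`); [SilvermanAEC2009] VII.5 Prop. 5.1 (`v(j) < 0` at a multiplicative
prime); [Fouquet2025] (the tree's `v_q(j) = −v_q(Δ_min)` lemma).
-/

set_option linter.dupNamespace false -- `Summit.BirchSwinnertonDyer.BirchSwinnertonDyer` (summit = problem), tree-wide

noncomputable section

open scoped Classical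

namespace Summit.BirchSwinnertonDyer.BirchSwinnertonDyer.Theorems.CornerShape

open WeierstrassCurve
  Literature.NumberTheory.EllipticCurves
  Literature.NumberTheory.EllipticCurves.Rank1Residual
  Summit.BirchSwinnertonDyer.Rank1Residual

/-! ### §1. `5`-adic valuation of `J₉(t) = t³(t² + 5t + 40)` -/

/-- `t² + 5t + 40 ≠ 0` for rational `t` (it is `(t + 5/2)² + 135/4 > 0`). [folklore] -/
theorem J9_quadratic_ne_zero (t : ℚ) : t ^ 2 + 5 * t + 40 ≠ 0 := by
  have h : (0 : ℚ) < t ^ 2 + 5 * t + 40 := by nlinarith [sq_nonneg (t + 5 / 2)]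
  exact ne_of_gt h

/-- **For `v₅(t) < 0`: `v₅(t³(t² + 5t + 40)) = 5·v₅(t)`** (ultrametric inequality: `v₅(t²) = 2v₅(t)` is
strictly smaller than `v₅(5t + 40) = 1 + v₅(t + 8) = 1 + v₅(t)`). [folklore] -/
theorem padicValRat_J9_of_padicValRat_neg {t : ℚ} (ht : padicValRat 5 t < 0) :
    padicValRat 5 (t ^ 3 * (t ^ 2 + 5 * t + 40)) = 5 * padicValRat 5 t := by
  haveI : Fact (Nat.Prime 5) := ⟨by norm_num⟩
  have ht0 : t ≠ 0 := by rintro rfl; simp at ht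
  have ht8 : t + 8 ≠ 0 := by
    intro h
    have : t = -8 := by linarith
    rw [this, show (-8 : ℚ) = ((-8 : ℤ) : ℚ) by norm_num, padicValRat.of_int] at ht
    have h0 : (0 : ℤ) ≤ padicValInt 5 (-8) := by exact_mod_cast (padicValInt 5 (-8)).zero_le
    omega
  -- `v(t + 8) = v(t)` since `v(t) < 0 = v(8)`
  have h8 : padicValRat 5 (8 : ℚ) = 0 := by
    rw [show (8 : ℚ) = ((8 : ℕ) : ℚ) by norm_num, padicValRat.of_nat]
    norm_num [padicValNat.eq_zero_of_not_dvd]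
  have hvt8 : padicValRat 5 (t + 8) = padicValRat 5 t :=
    padicValRat.add_eq_of_lt ht8 ht0 (by norm_num) (by rw [h8]; exact ht)
  -- `v(5t + 40) = 1 + v(t)`
  have h540 : (5 : ℚ) * t + 40 = 5 * (t + 8) := by ring
  have hv540 : padicValRat 5 (5 * t + 40) = 1 + padicValRat 5 t := by
    rw [h540, padicValRat.mul (by norm_num) ht8, hvt8,
      show (5 : ℚ) = ((5 : ℕ) : ℚ) by norm_num, padicValRat.self (by norm_num)]
  -- `v(t²) = 2 v(t) < 1 + v(t)`
  have hvt2 : padicValRat 5 (t ^ 2) = 2 * padicValRat 5 t := by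
    rw [padicValRat.pow]; push_cast; ring
  have hq0 : t ^ 2 + 5 * t + 40 ≠ 0 := J9_quadratic_ne_zero t
  have h5t40 : (5 : ℚ) * t + 40 ≠ 0 := by rw [h540]; exact mul_ne_zero (by norm_num) ht8
  have hvq : padicValRat 5 (t ^ 2 + 5 * t + 40) = 2 * padicValRat 5 t := by
    have := padicValRat.add_eq_of_lt (p := 5) (q := t ^ 2) (r := 5 * t + 40)
      (by rw [← add_assoc]; exact hq0) (pow_ne_zero 2 ht0) h5t40 (by rw [hvt2, hv540]; linarith)
    rw [add_assoc, this, hvt2]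
  rw [padicValRat.mul (pow_ne_zero 3 ht0) hq0, padicValRat.pow, hvq]
  push_cast
  ring

/-- **For `v₅(t) ≥ 0`: `v₅(t³(t² + 5t + 40)) ≥ 0`** (a polynomial with integer coefficients at a
`5`-integral argument; for `t = 0` the value is `0`, of valuation `0` by convention). [folklore] -/
theorem padicValRat_J9_nonneg_of_padicValRat_nonneg {t : ℚ} (ht : 0 ≤ padicValRat 5 t) :
    0 ≤ padicValRat 5 (t ^ 3 * (t ^ 2 + 5 * t + 40)) := by
  haveI : Fact (Nat.Prime 5) := ⟨by norm_num⟩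
  by_cases ht0 : t = 0
  · simp [ht0]
  have hq0 : t ^ 2 + 5 * t + 40 ≠ 0 := J9_quadratic_ne_zero t
  have h40 : padicValRat 5 (40 : ℚ) = 1 := by
    rw [show (40 : ℚ) = 5 * 8 by norm_num, padicValRat.mul (by norm_num) (by norm_num),
      show (5 : ℚ) = ((5 : ℕ) : ℚ) by norm_num, padicValRat.self (by norm_num),
      show (8 : ℚ) = ((8 : ℕ) : ℚ) by norm_num, padicValRat.of_nat]
    norm_num [padicValNat.eq_zero_of_not_dvd]
  have hv5t : 0 ≤ padicValRat 5 (5 * t) := by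
    rw [padicValRat.mul (by norm_num) ht0, show (5 : ℚ) = ((5 : ℕ) : ℚ) by norm_num,
      padicValRat.self (by norm_num)]
    linarith
  have hvt2 : 0 ≤ padicValRat 5 (t ^ 2) := by rw [padicValRat.pow]; push_cast; nlinarith
  -- `v(5t + 40) ≥ 0`
  have h1 : 0 ≤ padicValRat 5 (5 * t + 40) := by
    by_cases h0 : (5 : ℚ) * t + 40 = 0
    · simp [h0]
    exact le_trans (le_min hv5t (by rw [h40]; norm_num)) (padicValRat.min_le_padicValRat_add h0)
  have h2 : 0 ≤ padicValRat 5 (t ^ 2 + 5 * t + 40) := by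
    have := padicValRat.min_le_padicValRat_add (p := 5) (q := t ^ 2) (r := 5 * t + 40)
      (by rw [← add_assoc]; exact hq0)
    rw [← add_assoc] at this
    exact le_trans (le_min hvt2 h1) this
  rw [padicValRat.mul (pow_ne_zero 3 ht0) hq0, padicValRat.pow]
  push_cast
  nlinarith

/-! ### §2. A multiplicative `5` on the `J₉`-line -/

variable (W : WeierstrassCurve ℚ) [W.IsElliptic] [W.IsGloballyMinimal]

/-- **A multiplicative `5` on the `J₉`-line forces `v₅(t) < 0`**: `v₅(j) = −v₅(Δ_min) ≤ −1 < 0`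
(Silverman VII.5.1 in the tree's form), while `v₅(t) ≥ 0` would give `v₅(j) ≥ 0`.
[cite: SilvermanAEC2009, VII.5 Prop. 5.1] [cite: Zywina2015, §1.3 (J₉)] -/
theorem padicValRat_lt_zero_of_mult_of_j_eq_J9 [Fact (Nat.Prime 5)] (hmult : Mult W 5) {t : ℚ}
    (hj : W.j = t ^ 3 * (t ^ 2 + 5 * t + 40)) : padicValRat 5 t < 0 := by
  rcases lt_or_ge (padicValRat 5 t) 0 with h | h
  · exact h
  · exfalso
    have hv := Fouquet2025.padicValRat_j_of_hasMultiplicativeReductionAtPrime W 5 hmult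
    have h1 := one_le_padicValInt_minimalDiscriminantInt W hmult
    have h0 := padicValRat_J9_nonneg_of_padicValRat_nonneg h
    rw [← hj, hv] at h0
    omega

/-- **`v₅(Δ_min) = −5·v₅(t)` for a multiplicative `5` on the `J₉`-line** (`v₅(j) = 5v₅(t)` and
`v₅(j) = −v₅(Δ_min)`). [cite: SilvermanAEC2009, VII.5 Prop. 5.1] [cite: Zywina2015, §1.3 (J₉)] -/
theorem ordMinimalDiscriminant_eq_of_mult_of_j_eq_J9 [Fact (Nat.Prime 5)] (hmult : Mult W 5) {t : ℚ}
    (hj : W.j = t ^ 3 * (t ^ 2 + 5 * t + 40)) :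
    (padicValInt 5 W.minimalDiscriminantInt : ℤ) = -5 * padicValRat 5 t := by
  have ht := padicValRat_lt_zero_of_mult_of_j_eq_J9 W hmult hj
  have hv := Fouquet2025.padicValRat_j_of_hasMultiplicativeReductionAtPrime W 5 hmult
  have h5 := padicValRat_J9_of_padicValRat_neg ht
  rw [← hj, hv] at h5
  linarith

/-- **`5 ∣ v₅(Δ_min)`** for a multiplicative `5` on the `J₉`-line — the crux binder, from the curve.
[cite: Zywina2015, §1.3 (J₉)] -/
theorem five_dvd_ordMinimalDiscriminant_of_mult_of_j_eq_J9 [Fact (Nat.Prime 5)] (hmult : Mult W 5)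
    {t : ℚ} (hj : W.j = t ^ 3 * (t ^ 2 + 5 * t + 40)) :
    (5 : ℤ) ∣ padicValInt 5 W.minimalDiscriminantInt :=
  ⟨-padicValRat 5 t, by rw [ordMinimalDiscriminant_eq_of_mult_of_j_eq_J9 W hmult hj]; ring⟩

/-- **`5 ≤ v₅(Δ_min)`** for a multiplicative `5` on the `J₉`-line (`v₅(t) ≤ −1`).
[cite: Zywina2015, §1.3 (J₉)] -/
theorem five_le_ordMinimalDiscriminant_of_mult_of_j_eq_J9 [Fact (Nat.Prime 5)] (hmult : Mult W 5)
    {t : ℚ} (hj : W.j = t ^ 3 * (t ^ 2 + 5 * t + 40)) :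
    (5 : ℤ) ≤ padicValInt 5 W.minimalDiscriminantInt := by
  have ht := padicValRat_lt_zero_of_mult_of_j_eq_J9 W hmult hj
  rw [ordMinimalDiscriminant_eq_of_mult_of_j_eq_J9 W hmult hj]
  omega

/-! ### §3. On the corner -/

/-- **THE PARAMETER OF A CORNER PAIR AT `5`**: every corner pair `(E, 5)` (`ClassX11b W 5`, `ρ̄_{E,5}` not
onto) has `j(E) = t³(t² + 5t + 40)` for some `t ∈ ℚ` with `v₅(t) < 0` and `v₅(Δ_min(E)) = −5·v₅(t)`
(given Zywina's Thm. 1.4, `i = 9`, «only if» by name: `hZ`). The 64 census pairs all have `v₅(t) = −1`,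
`v₅(Δ_min) = 5`. [cite: Zywina2015, Thm. 1.4 (second item, i = 9), §1.3] [cite: SilvermanAEC2009, VII.5 Prop. 5.1] -/
theorem NonSurjCorner.exists_t_five [Fact (Nat.Prime 5)]
    (hZ : zywina2015_thm14_exists_j_eq_J9_of_zywinaG9_five) (hX : ClassX11b W 5) (hns : ¬ Surj W 5) :
    ∃ t : ℚ, W.j = t ^ 3 * (t ^ 2 + 5 * t + 40) ∧ padicValRat 5 t < 0 ∧
      (padicValInt 5 W.minimalDiscriminantInt : ℤ) = -5 * padicValRat 5 t := by
  obtain ⟨t, hj⟩ := NonSurjCorner.exists_j_eq_J9_five W hZ hX hns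
  exact ⟨t, hj, padicValRat_lt_zero_of_mult_of_j_eq_J9 W hX.2.2.1 hj,
    ordMinimalDiscriminant_eq_of_mult_of_j_eq_J9 W hX.2.2.1 hj⟩

end Summit.BirchSwinnertonDyer.BirchSwinnertonDyer.Theorems.CornerShape

end
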